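import Mathlib
import Summits.MatrixMultiplication.MatrixMultiplication.Theorems.SubgroupIdentityDesigns.Negative.NormOneTorus
import Summits.MatrixMultiplication.MatrixMultiplication.Theorems.SubgroupIdentityDesigns.Negative.DesignConj

/-!
# The norm-one torus certificate at the END members

Route `LevelGradedCohnUmans`, crux `SubgroupIdentityDesigns`, the `(m,k) = (2,1)` cell, `p`-free
case.  `NormOneTorus.no_levelOne_design_of_normOne_torus₂` treats a copy of
`O₂⁻(𝔽_p) = SO(Q)⋊⟨σ⟩` inside the MIDDLE member.  Here the three ingredients are factored out as
lemmas — `sigma_not_mem_normOne`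
(`σ ∉ SO(Q)` for `p` odd), `normOne_free` (free action on non-zero vectors, by anisotropy) and
`normOne_transport` (the explicit `k' = M(σ k a) M(a)⁻¹ ∈ SO(Q)` with `σ k' a = k a`) — and the
certificate is recorded for the FIRST and LAST members as well
(`no_levelOne_design_of_normOne_torus₁/₃`).  Since the identity design is not invariant under
permuting the members, all three placements are needed.  Finally the CONJUGATE forms
`no_levelOne_design_of_normOne_torus_conj₁/₂/₃` (a member containing `x·O₂⁻(𝔽_p)·x⁻¹`, via
`DesignConj.design_conj`).  All odd `p`; no TPP, no volume hypothesis.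
VALUE = THEOREM, NOT summit progress; the crux item stmt-MatrixMultiplication-14079 is untouched and
remains open.
-/

set_option linter.dupNamespace false

noncomputable section

open scoped BigOperators Classical

open Summit.MatrixMultiplication.MatrixMultiplication.Theorems.LieRankDesigns.Negative (GLm Mat)

namespace Summit.MatrixMultiplication.MatrixMultiplication.Theorems.SubgroupIdentityDesigns.Negative

section NormOneTorusEnds

variable {p : ℕ} [hp : Fact p.Prime]

/-- `σ = diag(1,-1)` is not of the shape `[[x, n y],[y, x]]` when `p` is odd. -/
theorem sigma_not_mem_normOne (hp2 : p ≠ 2) {n : ZMod p} {K : Subgroup (GLm p 2)}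
    (hKshape : ∀ k ∈ K, ((k : GLm p 2) : Mat p 2) 0 1 = n * ((k : GLm p 2) : Mat p 2) 1 0 ∧
      ((k : GLm p 2) : Mat p 2) 1 1 = ((k : GLm p 2) : Mat p 2) 0 0 ∧
      ((k : GLm p 2) : Mat p 2) 0 0 * ((k : GLm p 2) : Mat p 2) 0 0 -
        n * (((k : GLm p 2) : Mat p 2) 1 0 * ((k : GLm p 2) : Mat p 2) 1 0) = 1)
    {s : GLm p 2} (hs00 : (s : Mat p 2) 0 0 = 1) (hs11 : (s : Mat p 2) 1 1 = -1) : s ∉ K := by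
  intro hsK
  have h := (hKshape s hsK).2.1
  rw [hs00, hs11] at h
  have h2 : ((2 : ℕ) : ZMod p) = 0 := by
    have : (2 : ZMod p) = 0 := by linear_combination -h
    exact_mod_cast this
  rw [CharP.cast_eq_zero_iff (ZMod p) p] at h2
  exact hp2 ((Nat.prime_dvd_prime_iff_eq hp.out Nat.prime_two).mp h2)

/-- `SO(Q)` acts freely on non-zero vectors (anisotropy of `Q`). -/
theorem normOne_free {n : ZMod p} (hn : ∀ x : ZMod p, x * x ≠ n) {K : Subgroup (GLm p 2)}
    (hKshape : ∀ k ∈ K, ((k : GLm p 2) : Mat p 2) 0 1 = n * ((k : GLm p 2) : Mat p 2) 1 0 ∧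
      ((k : GLm p 2) : Mat p 2) 1 1 = ((k : GLm p 2) : Mat p 2) 0 0 ∧
      ((k : GLm p 2) : Mat p 2) 0 0 * ((k : GLm p 2) : Mat p 2) 0 0 -
        n * (((k : GLm p 2) : Mat p 2) 1 0 * ((k : GLm p 2) : Mat p 2) 1 0) = 1) :
    ∀ a : Fin 2 → ZMod p, a ≠ 0 → ∀ k ∈ K, ∀ k' ∈ K,
      ((k : GLm p 2) : Mat p 2).mulVec a = ((k' : GLm p 2) : Mat p 2).mulVec a → k = k' := by
  intro a ha k hk k' hk' e
  obtain ⟨h01, h11, -⟩ := hKshape k hk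
  obtain ⟨h01', h11', -⟩ := hKshape k' hk'
  have e0 := congr_fun e 0
  have e1 := congr_fun e 1
  rw [mulVec_two_apply_zero, mulVec_two_apply_zero] at e0
  rw [mulVec_two_apply_one, mulVec_two_apply_one] at e1
  obtain ⟨hX, hY⟩ := shape_kernel hn ha
    (X := ((k : GLm p 2) : Mat p 2) 0 0 - ((k' : GLm p 2) : Mat p 2) 0 0)
    (Y := ((k : GLm p 2) : Mat p 2) 1 0 - ((k' : GLm p 2) : Mat p 2) 1 0)
    (by linear_combination e0 - a 1 * h01 + a 1 * h01')
    (by linear_combination e1 - a 1 * h11 + a 1 * h11')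
  have hX' := sub_eq_zero.mp hX
  have hY' := sub_eq_zero.mp hY
  exact gl2_ext hX' (by rw [h01, h01', hY']) hY' (by rw [h11, h11', hX'])

/-- Transport inside `SO(Q)`: for `k ∈ SO(Q)` and `a ≠ 0` there is `k' ∈ SO(Q)` with
`σ k' a = k a` (explicitly `k' = M(σ k a) M(a)⁻¹`). -/
theorem normOne_transport {n : ZMod p} (hn : ∀ x : ZMod p, x * x ≠ n) {K : Subgroup (GLm p 2)}
    (hKshape : ∀ k ∈ K, ((k : GLm p 2) : Mat p 2) 0 1 = n * ((k : GLm p 2) : Mat p 2) 1 0 ∧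
      ((k : GLm p 2) : Mat p 2) 1 1 = ((k : GLm p 2) : Mat p 2) 0 0 ∧
      ((k : GLm p 2) : Mat p 2) 0 0 * ((k : GLm p 2) : Mat p 2) 0 0 -
        n * (((k : GLm p 2) : Mat p 2) 1 0 * ((k : GLm p 2) : Mat p 2) 1 0) = 1)
    (hKall : ∀ k : GLm p 2, (k : Mat p 2) 0 1 = n * (k : Mat p 2) 1 0 →
      (k : Mat p 2) 1 1 = (k : Mat p 2) 0 0 →
      (k : Mat p 2) 0 0 * (k : Mat p 2) 0 0 - n * ((k : Mat p 2) 1 0 * (k : Mat p 2) 1 0) = 1 →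
      k ∈ K)
    {s : GLm p 2} (hs00 : (s : Mat p 2) 0 0 = 1) (hs01 : (s : Mat p 2) 0 1 = 0)
    (hs10 : (s : Mat p 2) 1 0 = 0) (hs11 : (s : Mat p 2) 1 1 = -1) :
    ∀ a : Fin 2 → ZMod p, a ≠ 0 → ∀ k ∈ K, ∃ k' ∈ K,
      ((s * k' : GLm p 2) : Mat p 2).mulVec a = ((k : GLm p 2) : Mat p 2).mulVec a := by
  intro a ha k hk
  obtain ⟨h01, h11, hdet⟩ := hKshape k hk
  have hQ : a 0 * a 0 - n * (a 1 * a 1) ≠ 0 := by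
    intro hQ
    obtain ⟨h0, h1⟩ := anisotropic_of_nonsquare hn (sub_eq_zero.mp hQ)
    apply ha
    funext i
    fin_cases i
    · simpa using h0
    · simpa using h1
  -- name the entries; `t₀ = x a₀ + n y a₁`, `t₁ = -(y a₀ + x a₁)`, `Q = a₀² - n a₁²`
  set x := ((k : GLm p 2) : Mat p 2) 0 0 with hx
  set y := ((k : GLm p 2) : Mat p 2) 1 0 with hy
  have hB : ((x * a 0 + n * y * a 1) * a 0 - n * (-(y * a 0 + x * a 1)) * a 1) *
        ((x * a 0 + n * y * a 1) * a 0 - n * (-(y * a 0 + x * a 1)) * a 1) -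
      n * ((-(y * a 0 + x * a 1) * a 0 - (x * a 0 + n * y * a 1) * a 1) *
        (-(y * a 0 + x * a 1) * a 0 - (x * a 0 + n * y * a 1) * a 1)) =
      (a 0 * a 0 - n * (a 1 * a 1)) * (a 0 * a 0 - n * (a 1 * a 1)) := by
    linear_combination (a 0 * a 0 - n * (a 1 * a 1)) * (a 0 * a 0 - n * (a 1 * a 1)) * hdet
  have hdet1 := div_form_eq_one hQ hB
  obtain ⟨k', h00', h01', h10', h11'⟩ := exists_gl2
    (((x * a 0 + n * y * a 1) * a 0 - n * (-(y * a 0 + x * a 1)) * a 1) /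
      (a 0 * a 0 - n * (a 1 * a 1)))
    (n * (((-(y * a 0 + x * a 1)) * a 0 - (x * a 0 + n * y * a 1) * a 1) /
      (a 0 * a 0 - n * (a 1 * a 1))))
    (((-(y * a 0 + x * a 1)) * a 0 - (x * a 0 + n * y * a 1) * a 1) /
      (a 0 * a 0 - n * (a 1 * a 1)))
    (((x * a 0 + n * y * a 1) * a 0 - n * (-(y * a 0 + x * a 1)) * a 1) /
      (a 0 * a 0 - n * (a 1 * a 1)))
    (by rw [div_form_eq_one' hQ hB]; exact one_ne_zero)
  have hdet' : (k' : Mat p 2) 0 0 * (k' : Mat p 2) 0 0 -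
      n * ((k' : Mat p 2) 1 0 * (k' : Mat p 2) 1 0) = 1 := by
    rw [h00', h10']
    exact hdet1
  refine ⟨k', hKall k' (by rw [h01', h10']) (by rw [h11', h00']) hdet', ?_⟩
  -- `σ k' a = k a`
  have hv0 : (k' : Mat p 2).mulVec a 0 = x * a 0 + n * y * a 1 := by
    rw [mulVec_two_apply_zero, h00', h01']
    rw [show ∀ N₁ N₂ : ZMod p, N₁ / (a 0 * a 0 - n * (a 1 * a 1)) * a 0 +
        n * (N₂ / (a 0 * a 0 - n * (a 1 * a 1))) * a 1 =
        (N₁ * a 0 + n * N₂ * a 1) / (a 0 * a 0 - n * (a 1 * a 1)) from fun _ _ => by ring]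
    rw [div_eq_iff hQ]
    ring
  have hv1 : (k' : Mat p 2).mulVec a 1 = -(y * a 0 + x * a 1) := by
    rw [mulVec_two_apply_one, h10', h11']
    rw [show ∀ N₁ N₂ : ZMod p, N₂ / (a 0 * a 0 - n * (a 1 * a 1)) * a 0 +
        N₁ / (a 0 * a 0 - n * (a 1 * a 1)) * a 1 =
        (N₂ * a 0 + N₁ * a 1) / (a 0 * a 0 - n * (a 1 * a 1)) from fun _ _ => by ring]
    rw [div_eq_iff hQ]
    ring
  rw [Units.val_mul, ← Matrix.mulVec_mulVec]
  funext i
  fin_cases i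
  · simp only [Fin.zero_eta, Fin.isValue]
    rw [mulVec_two_apply_zero, hs00, hs01, hv0, hv1, mulVec_two_apply_zero, h01]
    ring
  · simp only [Fin.mk_one, Fin.isValue]
    rw [mulVec_two_apply_one, hs10, hs11, hv0, hv1, mulVec_two_apply_one, h11]
    ring

/-- **No level-one identity design when the FIRST member contains `O₂⁻(𝔽_p)`** (`p` odd). -/
theorem no_levelOne_design_of_normOne_torus₁ {H₁ H₂ H₃ : Subgroup (GLm p 2)} (hp2 : p ≠ 2)
    (n : ZMod p) (hn : ∀ x : ZMod p, x * x ≠ n) (K : Subgroup (GLm p 2))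
    (hKshape : ∀ k ∈ K, ((k : GLm p 2) : Mat p 2) 0 1 = n * ((k : GLm p 2) : Mat p 2) 1 0 ∧
      ((k : GLm p 2) : Mat p 2) 1 1 = ((k : GLm p 2) : Mat p 2) 0 0 ∧
      ((k : GLm p 2) : Mat p 2) 0 0 * ((k : GLm p 2) : Mat p 2) 0 0 -
        n * (((k : GLm p 2) : Mat p 2) 1 0 * ((k : GLm p 2) : Mat p 2) 1 0) = 1)
    (hKall : ∀ k : GLm p 2, (k : Mat p 2) 0 1 = n * (k : Mat p 2) 1 0 →
      (k : Mat p 2) 1 1 = (k : Mat p 2) 0 0 →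
      (k : Mat p 2) 0 0 * (k : Mat p 2) 0 0 - n * ((k : Mat p 2) 1 0 * (k : Mat p 2) 1 0) = 1 →
      k ∈ K)
    (hKH : K ≤ H₁) (s : GLm p 2) (hs : s ∈ H₁) (hs00 : (s : Mat p 2) 0 0 = 1)
    (hs01 : (s : Mat p 2) 0 1 = 0) (hs10 : (s : Mat p 2) 1 0 = 0) (hs11 : (s : Mat p 2) 1 1 = -1) :
    ¬ ∃ c : Mat p 2 → ℂ, (∀ M, 1 < M.rank → c M = 0) ∧
      (∑ M, c M * ZMod.stdAddChar (Matrix.trace (M * ((1 : GLm p 2) : Mat p 2)))) = 1 ∧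
      ∀ a ∈ H₁, ∀ b ∈ H₂, ∀ g ∈ H₃, a * b * g ≠ 1 →
        (∑ M, c M *
          ZMod.stdAddChar (Matrix.trace (M * ((a * b * g : GLm p 2) : Mat p 2)))) = 0 :=
  no_levelOne_design_of_free_subgroup₁ K s hKH hs (sigma_not_mem_normOne hp2 hKshape hs00 hs11)
    (normOne_free hn hKshape) (normOne_transport hn hKshape hKall hs00 hs01 hs10 hs11)

/-- **No level-one identity design when the LAST member contains `O₂⁻(𝔽_p)`** (`p` odd). -/
theorem no_levelOne_design_of_normOne_torus₃ {H₁ H₂ H₃ : Subgroup (GLm p 2)} (hp2 : p ≠ 2)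
    (n : ZMod p) (hn : ∀ x : ZMod p, x * x ≠ n) (K : Subgroup (GLm p 2))
    (hKshape : ∀ k ∈ K, ((k : GLm p 2) : Mat p 2) 0 1 = n * ((k : GLm p 2) : Mat p 2) 1 0 ∧
      ((k : GLm p 2) : Mat p 2) 1 1 = ((k : GLm p 2) : Mat p 2) 0 0 ∧
      ((k : GLm p 2) : Mat p 2) 0 0 * ((k : GLm p 2) : Mat p 2) 0 0 -
        n * (((k : GLm p 2) : Mat p 2) 1 0 * ((k : GLm p 2) : Mat p 2) 1 0) = 1)
    (hKall : ∀ k : GLm p 2, (k : Mat p 2) 0 1 = n * (k : Mat p 2) 1 0 →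
      (k : Mat p 2) 1 1 = (k : Mat p 2) 0 0 →
      (k : Mat p 2) 0 0 * (k : Mat p 2) 0 0 - n * ((k : Mat p 2) 1 0 * (k : Mat p 2) 1 0) = 1 →
      k ∈ K)
    (hKH : K ≤ H₃) (s : GLm p 2) (hs : s ∈ H₃) (hs00 : (s : Mat p 2) 0 0 = 1)
    (hs01 : (s : Mat p 2) 0 1 = 0) (hs10 : (s : Mat p 2) 1 0 = 0) (hs11 : (s : Mat p 2) 1 1 = -1) :
    ¬ ∃ c : Mat p 2 → ℂ, (∀ M, 1 < M.rank → c M = 0) ∧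
      (∑ M, c M * ZMod.stdAddChar (Matrix.trace (M * ((1 : GLm p 2) : Mat p 2)))) = 1 ∧
      ∀ a ∈ H₁, ∀ b ∈ H₂, ∀ g ∈ H₃, a * b * g ≠ 1 →
        (∑ M, c M *
          ZMod.stdAddChar (Matrix.trace (M * ((a * b * g : GLm p 2) : Mat p 2)))) = 0 :=
  no_levelOne_design_of_free_subgroup₃ K s hKH hs (sigma_not_mem_normOne hp2 hKshape hs00 hs11)
    (normOne_free hn hKshape) (normOne_transport hn hKshape hKall hs00 hs01 hs10 hs11)

/-- **Conjugate form, FIRST member**: a member containing `x·O₂⁻(𝔽_p)·x⁻¹` (`p` odd). -/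
theorem no_levelOne_design_of_normOne_torus_conj₁ {H₁ H₂ H₃ : Subgroup (GLm p 2)} (hp2 : p ≠ 2)
    (n : ZMod p) (hn : ∀ x : ZMod p, x * x ≠ n) (K : Subgroup (GLm p 2))
    (hKshape : ∀ k ∈ K, ((k : GLm p 2) : Mat p 2) 0 1 = n * ((k : GLm p 2) : Mat p 2) 1 0 ∧
      ((k : GLm p 2) : Mat p 2) 1 1 = ((k : GLm p 2) : Mat p 2) 0 0 ∧
      ((k : GLm p 2) : Mat p 2) 0 0 * ((k : GLm p 2) : Mat p 2) 0 0 -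
        n * (((k : GLm p 2) : Mat p 2) 1 0 * ((k : GLm p 2) : Mat p 2) 1 0) = 1)
    (hKall : ∀ k : GLm p 2, (k : Mat p 2) 0 1 = n * (k : Mat p 2) 1 0 →
      (k : Mat p 2) 1 1 = (k : Mat p 2) 0 0 →
      (k : Mat p 2) 0 0 * (k : Mat p 2) 0 0 - n * ((k : Mat p 2) 1 0 * (k : Mat p 2) 1 0) = 1 →
      k ∈ K)
    (x : GLm p 2) (hKH : ∀ k ∈ K, x * k * x⁻¹ ∈ H₁) (s : GLm p 2) (hs : x * s * x⁻¹ ∈ H₁)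
    (hs00 : (s : Mat p 2) 0 0 = 1) (hs01 : (s : Mat p 2) 0 1 = 0) (hs10 : (s : Mat p 2) 1 0 = 0)
    (hs11 : (s : Mat p 2) 1 1 = -1) :
    ¬ ∃ c : Mat p 2 → ℂ, (∀ M, 1 < M.rank → c M = 0) ∧
      (∑ M, c M * ZMod.stdAddChar (Matrix.trace (M * ((1 : GLm p 2) : Mat p 2)))) = 1 ∧
      ∀ a ∈ H₁, ∀ b ∈ H₂, ∀ g ∈ H₃, a * b * g ≠ 1 →
        (∑ M, c M *
          ZMod.stdAddChar (Matrix.trace (M * ((a * b * g : GLm p 2) : Mat p 2)))) = 0 := by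
  intro h
  have hmap : ∀ (H : Subgroup (GLm p 2)) (k : GLm p 2), x * k * x⁻¹ ∈ H →
      k ∈ H.map (MulAut.conj x⁻¹).toMonoidHom := fun H k hk =>
    Subgroup.mem_map.mpr ⟨x * k * x⁻¹, hk, by
      simp only [MulEquiv.coe_toMonoidHom, MulAut.conj_apply, inv_inv]; group⟩
  exact no_levelOne_design_of_normOne_torus₁ (H₁ := H₁.map (MulAut.conj x⁻¹).toMonoidHom)
    (H₂ := H₂.map (MulAut.conj x⁻¹).toMonoidHom) (H₃ := H₃.map (MulAut.conj x⁻¹).toMonoidHom)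
    hp2 n hn K hKshape hKall (fun k hk => hmap H₁ k (hKH k hk)) s (hmap H₁ s hs) hs00 hs01 hs10 hs11
    (DesignConj.design_conj H₁ H₂ H₃ x⁻¹ h)

/-- **Conjugate form, MIDDLE member**: a member containing `x·O₂⁻(𝔽_p)·x⁻¹` (`p` odd). -/
theorem no_levelOne_design_of_normOne_torus_conj₂ {H₁ H₂ H₃ : Subgroup (GLm p 2)} (hp2 : p ≠ 2)
    (n : ZMod p) (hn : ∀ x : ZMod p, x * x ≠ n) (K : Subgroup (GLm p 2))
    (hKshape : ∀ k ∈ K, ((k : GLm p 2) : Mat p 2) 0 1 = n * ((k : GLm p 2) : Mat p 2) 1 0 ∧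
      ((k : GLm p 2) : Mat p 2) 1 1 = ((k : GLm p 2) : Mat p 2) 0 0 ∧
      ((k : GLm p 2) : Mat p 2) 0 0 * ((k : GLm p 2) : Mat p 2) 0 0 -
        n * (((k : GLm p 2) : Mat p 2) 1 0 * ((k : GLm p 2) : Mat p 2) 1 0) = 1)
    (hKall : ∀ k : GLm p 2, (k : Mat p 2) 0 1 = n * (k : Mat p 2) 1 0 →
      (k : Mat p 2) 1 1 = (k : Mat p 2) 0 0 →
      (k : Mat p 2) 0 0 * (k : Mat p 2) 0 0 - n * ((k : Mat p 2) 1 0 * (k : Mat p 2) 1 0) = 1 →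
      k ∈ K)
    (x : GLm p 2) (hKH : ∀ k ∈ K, x * k * x⁻¹ ∈ H₂) (s : GLm p 2) (hs : x * s * x⁻¹ ∈ H₂)
    (hs00 : (s : Mat p 2) 0 0 = 1) (hs01 : (s : Mat p 2) 0 1 = 0) (hs10 : (s : Mat p 2) 1 0 = 0)
    (hs11 : (s : Mat p 2) 1 1 = -1) :
    ¬ ∃ c : Mat p 2 → ℂ, (∀ M, 1 < M.rank → c M = 0) ∧
      (∑ M, c M * ZMod.stdAddChar (Matrix.trace (M * ((1 : GLm p 2) : Mat p 2)))) = 1 ∧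
      ∀ a ∈ H₁, ∀ b ∈ H₂, ∀ g ∈ H₃, a * b * g ≠ 1 →
        (∑ M, c M *
          ZMod.stdAddChar (Matrix.trace (M * ((a * b * g : GLm p 2) : Mat p 2)))) = 0 := by
  intro h
  have hmap : ∀ (H : Subgroup (GLm p 2)) (k : GLm p 2), x * k * x⁻¹ ∈ H →
      k ∈ H.map (MulAut.conj x⁻¹).toMonoidHom := fun H k hk =>
    Subgroup.mem_map.mpr ⟨x * k * x⁻¹, hk, by
      simp only [MulEquiv.coe_toMonoidHom, MulAut.conj_apply, inv_inv]; group⟩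
  exact no_levelOne_design_of_normOne_torus₂ (H₁ := H₁.map (MulAut.conj x⁻¹).toMonoidHom)
    (H₂ := H₂.map (MulAut.conj x⁻¹).toMonoidHom) (H₃ := H₃.map (MulAut.conj x⁻¹).toMonoidHom)
    hp2 n hn K hKshape hKall (fun k hk => hmap H₂ k (hKH k hk)) s (hmap H₂ s hs) hs00 hs01 hs10 hs11
    (DesignConj.design_conj H₁ H₂ H₃ x⁻¹ h)

/-- **Conjugate form, LAST member**: a member containing `x·O₂⁻(𝔽_p)·x⁻¹` (`p` odd). -/
theorem no_levelOne_design_of_normOne_torus_conj₃ {H₁ H₂ H₃ : Subgroup (GLm p 2)} (hp2 : p ≠ 2)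
    (n : ZMod p) (hn : ∀ x : ZMod p, x * x ≠ n) (K : Subgroup (GLm p 2))
    (hKshape : ∀ k ∈ K, ((k : GLm p 2) : Mat p 2) 0 1 = n * ((k : GLm p 2) : Mat p 2) 1 0 ∧
      ((k : GLm p 2) : Mat p 2) 1 1 = ((k : GLm p 2) : Mat p 2) 0 0 ∧
      ((k : GLm p 2) : Mat p 2) 0 0 * ((k : GLm p 2) : Mat p 2) 0 0 -
        n * (((k : GLm p 2) : Mat p 2) 1 0 * ((k : GLm p 2) : Mat p 2) 1 0) = 1)
    (hKall : ∀ k : GLm p 2, (k : Mat p 2) 0 1 = n * (k : Mat p 2) 1 0 →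
      (k : Mat p 2) 1 1 = (k : Mat p 2) 0 0 →
      (k : Mat p 2) 0 0 * (k : Mat p 2) 0 0 - n * ((k : Mat p 2) 1 0 * (k : Mat p 2) 1 0) = 1 →
      k ∈ K)
    (x : GLm p 2) (hKH : ∀ k ∈ K, x * k * x⁻¹ ∈ H₃) (s : GLm p 2) (hs : x * s * x⁻¹ ∈ H₃)
    (hs00 : (s : Mat p 2) 0 0 = 1) (hs01 : (s : Mat p 2) 0 1 = 0) (hs10 : (s : Mat p 2) 1 0 = 0)
    (hs11 : (s : Mat p 2) 1 1 = -1) :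
    ¬ ∃ c : Mat p 2 → ℂ, (∀ M, 1 < M.rank → c M = 0) ∧
      (∑ M, c M * ZMod.stdAddChar (Matrix.trace (M * ((1 : GLm p 2) : Mat p 2)))) = 1 ∧
      ∀ a ∈ H₁, ∀ b ∈ H₂, ∀ g ∈ H₃, a * b * g ≠ 1 →
        (∑ M, c M *
          ZMod.stdAddChar (Matrix.trace (M * ((a * b * g : GLm p 2) : Mat p 2)))) = 0 := by
  intro h
  have hmap : ∀ (H : Subgroup (GLm p 2)) (k : GLm p 2), x * k * x⁻¹ ∈ H →
      k ∈ H.map (MulAut.conj x⁻¹).toMonoidHom := fun H k hk =>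
    Subgroup.mem_map.mpr ⟨x * k * x⁻¹, hk, by
      simp only [MulEquiv.coe_toMonoidHom, MulAut.conj_apply, inv_inv]; group⟩
  exact no_levelOne_design_of_normOne_torus₃ (H₁ := H₁.map (MulAut.conj x⁻¹).toMonoidHom)
    (H₂ := H₂.map (MulAut.conj x⁻¹).toMonoidHom) (H₃ := H₃.map (MulAut.conj x⁻¹).toMonoidHom)
    hp2 n hn K hKshape hKall (fun k hk => hmap H₃ k (hKH k hk)) s (hmap H₃ s hs) hs00 hs01 hs10 hs11
    (DesignConj.design_conj H₁ H₂ H₃ x⁻¹ h)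

end NormOneTorusEnds

end Summit.MatrixMultiplication.MatrixMultiplication.Theorems.SubgroupIdentityDesigns.Negative

end
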